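import Summits.QuantumFields.YangMills.Theorems.BalabanUVNodesN21ShellSplitOfRecord13CoPH

/-!
# N21 (NE7c) · THE SHELL SPLIT OF RECORD, THE LAW: the per-top-cube (M1) of the term-level file IS `T4ShellMeasure.SlotAntiConcentration` ON THE RECORD's
# `a`-TRUNCATED DRESSED LAW `cubeLawOfDatum₉` — total mass = `Σ_s cubeWeightOfDatum₉`, mass of «`a` fails the lowered test» = `Σ_s shellPieceOfDatum₉`, NO mass on
# «`a` fails its own `ε_k`-test»; hence (M1) in the tree's measure currency ⇒ the integral-form (M1) that `sum_shellWeight_le_of_cubeAC` consumes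

R134 seat `pub-ymgap-dag-n21-d` (g9), node N21 = NE7c (NOT PRINTED, NOT proved), strategy s2; lane K3⁷ `SpineGivenEndpointR13SepCoPH` (stmt-QuantumFields-20544,
`--supports … --as helper`; COUNT-NEUTRAL).  Imports the term-level file `…N21ShellSplitOfRecord13CoPH` (hence the definition lane `…Defs` with `cubeLawOfDatum₉`).

WHAT THIS FILE PROVES (theorems only; 0 `def`, 0 `sorry`; NODE 00's generality `ϑ D g₀ os p g k`; displayed rows: (H-U), `0 ≤ w`, F3's (e1) integrability).
* §1 `measurableSet_cubeFail` · `one_sub_cubeChiAt_eq_indicator` · `cubeLawOfDatum₉_apply` (the law on a measurable set, summand by summand) ·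
  ★ `toReal_cubeLawOfDatum₉_univ` (TOTAL MASS = `Σ_s cubeWeightOfDatum₉ … t a s`) · ★ `toReal_cubeLawOfDatum₉_fail` (MASS OF «`a` FAILS AT THE LOWERED LETTER» =
  `Σ_s shellPieceOfDatum₉ … ρ t a s`) · ★ `cubeLawOfDatum₉_fail_self_eq_zero` (NO MASS where `a` fails its own `ε_k`-test: the law carries `a`'s cut) · `cubeLawOfDatum₉_univ_lt_top`.
* §2 ★★ `cubeAC_of_lawBound` (a relative bound of the failure event under the law ⇒ the integral-form (M1)) · ★★★ `cubeAC_of_slotAntiConcentration` (for ANY statistic `u`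
  reading the cube's two tests — `u < ε_k ↔ χ_a^{ε_k} = 1`, `u < ε_k(1−ρ) ↔ χ_a^{ε_k(1−ρ)} = 1`, e.g. the cube sup of the (2.16) plaquette variables over `η_k²` —
  `T4ShellMeasure.SlotAntiConcentration (cubeLawOfDatum₉ … t a) u ε_k ρ D` ⇒ `Σ_s shellPiece ≤ (D ρ)·Σ_s cubeWeight`, the hypothesis `hM1` of `sum_shellWeight_le_of_cubeAC` ∕
  `shellWeightBound_classSet₁₃_of_cubeAC` ∕ `…_crOfRecord₁₃At_shellSplit(_of_liveSel)`).

* §3 `summable_of_geomGrowth_mul_geomRate` — the END's tolerance at the top level: `D_K ≤ d₀Γ^K`, `ρ_K ≤ c₁ϑ^K`, `Γϑ < 1` ⇒ `Σ_K D_Kρ_K < ∞` (the two-run closeness of the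
  TOP cubes' statistics is a fine-lattice discretisation width, geometric in `K`; so the (M1) constant may grow geometrically below that rate).

So N21 AT THE RECORD reads, per (run, K, t, top cube a): `SlotAntiConcentration (cubeLawOfDatum₉ …) u_a ε_k ρ_K D_K` with `Σ_K D_K ρ_K < ∞` — the hazard ∕ dilation roads'
conclusion shape (`slotAntiConcentration_restrict_of_…`, parts 7–39) now asked of ONE DEFINITE MEASURE of record.  NOT PRINTED; NOT proved here.

HONEST FRAMING.  [folklore] measure bookkeeping (`withDensity`, `lintegral` ↔ Bochner, `ENNReal.toReal`); NO estimate; nothing of Bałaban's asserted; K0⁷ open; NE7c NOT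
proved; N21 NOT discharged; K3⁷ NOT claimed; counts UNMOVED (typed 28∕28 · discharged 5∕27); never a count claim.  No `instance`, no `notation`, no `def`.  One finite
four-torus programme at fixed `ε` — NOT ℝ⁴, NOT OS, NOT a mass gap, NOT the Clay problem.
-/

noncomputable section

open scoped BigOperators ENNReal
open Finset MeasureTheory

namespace Summit.QuantumFields.YangMills.Theorems.N21ShellSplitOfRecord13CoPH

open Literature.MathematicalPhysics.QuantumFieldTheory.Balaban1983to89
open Literature.MathematicalPhysics.QuantumFieldTheory.Balaban1983to89.T4Continuum
open Literature.MathematicalPhysics.QuantumFieldTheory.Balaban1983to89.Node00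
open T4ShellMeasure (SlotAntiConcentration)
open Summit.QuantumFields.YangMills.BalabanUVNodes.N19MGFRoadLiveSelectorTower (dressedSlotsOfDatum₉_nonneg)

section Law

variable (F : T4Family) (N : ℕ) [NeZero N] (ϑ : Stage9Params F N) (D : FiniteEpsData F (SU N)) (g₀ : ℕ → ℝ) (os : List (ULoop F))
  (p : B12.RunParams) (g : ℕ → ℝ) (k : ℕ)

/-! ## §1 The law on the two events and in total -/

/-- the event «cube `a` FAILS the (2.17) test at the letter `δ`» (`χ_a^{δ} = 0`) is measurable under (H-U). [bookkeeping] -/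
theorem measurableSet_cubeFail (hU : LocalBgMeasurable F N ϑ.ν) (δ : ℝ)
    (a : ↥(cubeIndices (F.P p.K) (cubeSide (F.P p.K).L ϑ.ν.M₂ (RkOfRecord (F.P p.K).L ϑ.ν.r (g k)) k))) :
    MeasurableSet {V : GaugeField (F.P p.K) k (SU N) | cubeChiAt F N ϑ.ν g p.K k δ a V = 0} :=
  measurable_cubeChiAt F N ϑ.ν g p.K k hU δ a (measurableSet_singleton 0)

/-- `1 − χ_a^{δ}` is the indicator of the failure event. [bookkeeping] -/
theorem one_sub_cubeChiAt_eq_indicator (δ : ℝ) (a : ↥(cubeIndices (F.P p.K) (cubeSide (F.P p.K).L ϑ.ν.M₂ (RkOfRecord (F.P p.K).L ϑ.ν.r (g k)) k)))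
    (f : GaugeField (F.P p.K) k (SU N) → ℝ) (V : GaugeField (F.P p.K) k (SU N)) :
    (1 - cubeChiAt F N ϑ.ν g p.K k δ a V) * f V = Set.indicator {V | cubeChiAt F N ϑ.ν g p.K k δ a V = 0} f V := by
  rcases cubeChiAt_eq_zero_or_one F N ϑ.ν g p.K k δ a V with h | h
  · rw [Set.indicator_of_mem (by exact h), h]; ring
  · rw [Set.indicator_of_notMem (by simp [h]), h]; ring

/-- the law on a measurable set, summand by summand (`Measure.finsetSum_apply`, `withDensity_apply`). [bookkeeping] -/
theorem cubeLawOfDatum₉_apply (t : ℝ) (a : ↥(cubeIndices (F.P p.K) (cubeSide (F.P p.K).L ϑ.ν.M₂ (RkOfRecord (F.P p.K).L ϑ.ν.r (g k)) k)))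
    {E : Set (GaugeField (F.P p.K) k (SU N))} (hE : MeasurableSet E) :
    cubeLawOfDatum₉ F N ϑ D g₀ os p g k t a E =
      ∑ s : SeqOfRecord F ϑ.ν ϑ.τ9.M g p.K k,
        if a ∈ cubesOfSeq F ϑ.ν ϑ.τ9.M g p.K k s then
          ∫⁻ V in E, ENNReal.ofReal (chiSeqOfRecord F N ϑ.ν ϑ.τ9.M g p.K k s V * dressedSlotsOfDatum₉ F N ϑ D g₀ os t p g k s V)
            ∂fieldMeasure (F.P p.K) k (SU N)
        else 0 := by
  rw [cubeLawOfDatum₉, Measure.finsetSum_apply]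
  refine Finset.sum_congr rfl fun s _ => ?_
  split_ifs with h
  · exact withDensity_apply _ hE
  · rfl

/-- ★ **TOTAL MASS = THE TRUNCATED CLASS WEIGHTS** (F3's (e1) integrability and `0 ≤ w` displayed): `(cubeLaw t a univ).toReal = Σ_s cubeWeightOfDatum₉ … t a s`.
[bookkeeping] -/
theorem toReal_cubeLawOfDatum₉_univ (hw0 : ∀ k s' U V', 0 ≤ wOfRecord₉ F N ϑ p g k s' U V') (t : ℝ)
    (a : ↥(cubeIndices (F.P p.K) (cubeSide (F.P p.K).L ϑ.ν.M₂ (RkOfRecord (F.P p.K).L ϑ.ν.r (g k)) k)))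
    (hint : ∀ s : SeqOfRecord F ϑ.ν ϑ.τ9.M g p.K k,
      Integrable (fun V => chiSeqOfRecord F N ϑ.ν ϑ.τ9.M g p.K k s V * dressedSlotsOfDatum₉ F N ϑ D g₀ os t p g k s V) (fieldMeasure (F.P p.K) k (SU N))) :
    (cubeLawOfDatum₉ F N ϑ D g₀ os p g k t a Set.univ).toReal = ∑ s, cubeWeightOfDatum₉ F N ϑ D g₀ os p g k t a s := by
  have hnn : ∀ (s : SeqOfRecord F ϑ.ν ϑ.τ9.M g p.K k) V,
      0 ≤ chiSeqOfRecord F N ϑ.ν ϑ.τ9.M g p.K k s V * dressedSlotsOfDatum₉ F N ϑ D g₀ os t p g k s V :=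
    fun s V => mul_nonneg (chiSeqOfRecord_nonneg F N ϑ.ν ϑ.τ9.M g p.K k s V) (dressedSlotsOfDatum₉_nonneg F N ϑ D g₀ os p g hw0 t k s V)
  have hterm : ∀ s : SeqOfRecord F ϑ.ν ϑ.τ9.M g p.K k,
      (if a ∈ cubesOfSeq F ϑ.ν ϑ.τ9.M g p.K k s then
          ∫⁻ V in Set.univ, ENNReal.ofReal (chiSeqOfRecord F N ϑ.ν ϑ.τ9.M g p.K k s V * dressedSlotsOfDatum₉ F N ϑ D g₀ os t p g k s V)
            ∂fieldMeasure (F.P p.K) k (SU N)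
        else 0) = ENNReal.ofReal (cubeWeightOfDatum₉ F N ϑ D g₀ os p g k t a s) := by
    intro s
    split_ifs with h
    · rw [Measure.restrict_univ, cubeWeightOfDatum₉_of_mem F N ϑ D g₀ os p g k h, classWeightOfDatum₉,
        ofReal_integral_eq_lintegral_ofReal (hint s) (ae_of_all _ (hnn s))]
    · rw [cubeWeightOfDatum₉_of_not_mem F N ϑ D g₀ os p g k h, ENNReal.ofReal_zero]
  rw [cubeLawOfDatum₉_apply F N ϑ D g₀ os p g k t a MeasurableSet.univ, Finset.sum_congr rfl fun s _ => hterm s,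
    ENNReal.toReal_sum fun s _ => ENNReal.ofReal_ne_top]
  exact Finset.sum_congr rfl fun s _ => ENNReal.toReal_ofReal (cubeWeightOfDatum₉_nonneg F N ϑ D g₀ os p g k hw0 t a s)

/-- ★ **MASS OF «`a` FAILS AT THE LOWERED LETTER» = THE SHELL PIECES**: `(cubeLaw t a {χ_a^{ε_k(1−ρ)} = 0}).toReal = Σ_s shellPieceOfDatum₉ … ρ t a s` ((H-U), `0 ≤ w`,
F3's (e1) integrability displayed). [bookkeeping] -/
theorem toReal_cubeLawOfDatum₉_fail (hU : LocalBgMeasurable F N ϑ.ν) (hw0 : ∀ k s' U V', 0 ≤ wOfRecord₉ F N ϑ p g k s' U V') (ρ t : ℝ)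
    (a : ↥(cubeIndices (F.P p.K) (cubeSide (F.P p.K).L ϑ.ν.M₂ (RkOfRecord (F.P p.K).L ϑ.ν.r (g k)) k)))
    (hint : ∀ s : SeqOfRecord F ϑ.ν ϑ.τ9.M g p.K k,
      Integrable (fun V => chiSeqOfRecord F N ϑ.ν ϑ.τ9.M g p.K k s V * dressedSlotsOfDatum₉ F N ϑ D g₀ os t p g k s V) (fieldMeasure (F.P p.K) k (SU N))) :
    (cubeLawOfDatum₉ F N ϑ D g₀ os p g k t a
        {V | cubeChiAt F N ϑ.ν g p.K k (epsOfRecord ϑ.ν g k * (1 - ρ)) a V = 0}).toReal =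
      ∑ s, shellPieceOfDatum₉ F N ϑ D g₀ os p g k ρ t a s := by
  set E := {V : GaugeField (F.P p.K) k (SU N) | cubeChiAt F N ϑ.ν g p.K k (epsOfRecord ϑ.ν g k * (1 - ρ)) a V = 0} with hEdef
  have hE : MeasurableSet E := measurableSet_cubeFail F N ϑ p g k hU _ a
  have hnn : ∀ (s : SeqOfRecord F ϑ.ν ϑ.τ9.M g p.K k) V,
      0 ≤ chiSeqOfRecord F N ϑ.ν ϑ.τ9.M g p.K k s V * dressedSlotsOfDatum₉ F N ϑ D g₀ os t p g k s V :=
    fun s V => mul_nonneg (chiSeqOfRecord_nonneg F N ϑ.ν ϑ.τ9.M g p.K k s V) (dressedSlotsOfDatum₉_nonneg F N ϑ D g₀ os p g hw0 t k s V)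
  -- the restricted lintegral of the class-weight integrand over `E` is the piece (as an `ofReal`)
  have hterm : ∀ s : SeqOfRecord F ϑ.ν ϑ.τ9.M g p.K k,
      (if a ∈ cubesOfSeq F ϑ.ν ϑ.τ9.M g p.K k s then
          ∫⁻ V in E, ENNReal.ofReal (chiSeqOfRecord F N ϑ.ν ϑ.τ9.M g p.K k s V * dressedSlotsOfDatum₉ F N ϑ D g₀ os t p g k s V)
            ∂fieldMeasure (F.P p.K) k (SU N)
        else 0) = ENNReal.ofReal (shellPieceOfDatum₉ F N ϑ D g₀ os p g k ρ t a s) := by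
    intro s
    split_ifs with h
    · rw [shellPieceOfDatum₉_of_mem F N ϑ D g₀ os p g k h, ← lintegral_indicator hE,
        ofReal_integral_eq_lintegral_ofReal (integrable_pieceIntegrand F N ϑ D g₀ os p g k hU _ t a s (hint s))
          (ae_of_all _ fun V => pieceIntegrand_nonneg F N ϑ D g₀ os p g k hw0 _ t a s V)]
      refine lintegral_congr fun V => ?_
      by_cases hV : V ∈ E
      · have h0 : cubeChiAt F N ϑ.ν g p.K k (epsOfRecord ϑ.ν g k * (1 - ρ)) a V = 0 := hV
        rw [Set.indicator_of_mem hV, h0, sub_zero, one_mul]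
      · have h1 : cubeChiAt F N ϑ.ν g p.K k (epsOfRecord ϑ.ν g k * (1 - ρ)) a V = 1 :=
          (cubeChiAt_eq_zero_or_one F N ϑ.ν g p.K k _ a V).resolve_left hV
        rw [Set.indicator_of_notMem hV, h1, sub_self, zero_mul, ENNReal.ofReal_zero]
    · rw [shellPieceOfDatum₉_of_not_mem F N ϑ D g₀ os p g k h, ENNReal.ofReal_zero]
  rw [cubeLawOfDatum₉_apply F N ϑ D g₀ os p g k t a hE, Finset.sum_congr rfl fun s _ => hterm s,
    ENNReal.toReal_sum fun s _ => ENNReal.ofReal_ne_top]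
  exact Finset.sum_congr rfl fun s _ => ENNReal.toReal_ofReal (shellPieceOfDatum₉_nonneg F N ϑ D g₀ os p g k hw0 ρ t a s)

/-- ★ **NO MASS WHERE `a` FAILS ITS OWN `ε_k`-TEST**: the law carries `a`'s cut — on `{χ_a^{ε_k} = 0}` every summand's density `χ_k^{ε_k}(Ω_k(s))·slot_s` with `a ⊂ Ω_k(s)`
vanishes (the product has the factor `χ_a^{ε_k} = 0`). [bookkeeping] -/
theorem cubeLawOfDatum₉_fail_self_eq_zero (hU : LocalBgMeasurable F N ϑ.ν) (t : ℝ)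
    (a : ↥(cubeIndices (F.P p.K) (cubeSide (F.P p.K).L ϑ.ν.M₂ (RkOfRecord (F.P p.K).L ϑ.ν.r (g k)) k))) :
    cubeLawOfDatum₉ F N ϑ D g₀ os p g k t a {V | cubeChiAt F N ϑ.ν g p.K k (epsOfRecord ϑ.ν g k) a V = 0} = 0 := by
  have hE := measurableSet_cubeFail F N ϑ p g k hU (epsOfRecord ϑ.ν g k) a
  rw [cubeLawOfDatum₉_apply F N ϑ D g₀ os p g k t a hE]
  refine Finset.sum_eq_zero fun s _ => ?_
  split_ifs with h
  · refine setLIntegral_eq_zero hE fun V hV => ?_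
    have hχ : chiSeqOfRecord F N ϑ.ν ϑ.τ9.M g p.K k s V = 0 := by
      rw [chiSeqOfRecord_eq_at, chiSeqOfRecordAt_eq_prod_cubeChiAt]
      exact Finset.prod_eq_zero h hV
    simp [hχ]
  · rfl

/-- the law has finite total mass (F3's (e1) integrability). [bookkeeping] -/
theorem cubeLawOfDatum₉_univ_lt_top (hw0 : ∀ k s' U V', 0 ≤ wOfRecord₉ F N ϑ p g k s' U V') (t : ℝ)
    (a : ↥(cubeIndices (F.P p.K) (cubeSide (F.P p.K).L ϑ.ν.M₂ (RkOfRecord (F.P p.K).L ϑ.ν.r (g k)) k)))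
    (hint : ∀ s : SeqOfRecord F ϑ.ν ϑ.τ9.M g p.K k,
      Integrable (fun V => chiSeqOfRecord F N ϑ.ν ϑ.τ9.M g p.K k s V * dressedSlotsOfDatum₉ F N ϑ D g₀ os t p g k s V) (fieldMeasure (F.P p.K) k (SU N))) :
    cubeLawOfDatum₉ F N ϑ D g₀ os p g k t a Set.univ < ∞ := by
  have hnn : ∀ (s : SeqOfRecord F ϑ.ν ϑ.τ9.M g p.K k) V,
      0 ≤ chiSeqOfRecord F N ϑ.ν ϑ.τ9.M g p.K k s V * dressedSlotsOfDatum₉ F N ϑ D g₀ os t p g k s V :=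
    fun s V => mul_nonneg (chiSeqOfRecord_nonneg F N ϑ.ν ϑ.τ9.M g p.K k s V) (dressedSlotsOfDatum₉_nonneg F N ϑ D g₀ os p g hw0 t k s V)
  rw [cubeLawOfDatum₉_apply F N ϑ D g₀ os p g k t a MeasurableSet.univ]
  refine ENNReal.sum_lt_top.2 fun s _ => ?_
  split_ifs with h
  · rw [Measure.restrict_univ, ← ofReal_integral_eq_lintegral_ofReal (hint s) (ae_of_all _ (hnn s))]
    exact ENNReal.ofReal_lt_top
  · exact ENNReal.zero_lt_top

/-! ## §2 (M1) in the tree's measure currency ⇒ the integral-form (M1) -/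

/-- ★★ **A RELATIVE BOUND OF THE LOWERED-FAILURE EVENT UNDER THE LAW ⇒ THE INTEGRAL-FORM (M1)** consumed by `sum_shellWeight_le_of_cubeAC`:
`cubeLaw {χ_a^{ε_k(1−ρ)} = 0} ≤ ofReal c · cubeLaw univ` (`0 ≤ c`) ⇒ `Σ_s shellPiece ≤ c · Σ_s cubeWeight`. [bookkeeping] -/
theorem cubeAC_of_lawBound (hU : LocalBgMeasurable F N ϑ.ν) (hw0 : ∀ k s' U V', 0 ≤ wOfRecord₉ F N ϑ p g k s' U V') (ρ t : ℝ)
    (a : ↥(cubeIndices (F.P p.K) (cubeSide (F.P p.K).L ϑ.ν.M₂ (RkOfRecord (F.P p.K).L ϑ.ν.r (g k)) k)))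
    (hint : ∀ s : SeqOfRecord F ϑ.ν ϑ.τ9.M g p.K k,
      Integrable (fun V => chiSeqOfRecord F N ϑ.ν ϑ.τ9.M g p.K k s V * dressedSlotsOfDatum₉ F N ϑ D g₀ os t p g k s V) (fieldMeasure (F.P p.K) k (SU N)))
    {c : ℝ} (hc : 0 ≤ c)
    (h : cubeLawOfDatum₉ F N ϑ D g₀ os p g k t a {V | cubeChiAt F N ϑ.ν g p.K k (epsOfRecord ϑ.ν g k * (1 - ρ)) a V = 0} ≤
      ENNReal.ofReal c * cubeLawOfDatum₉ F N ϑ D g₀ os p g k t a Set.univ) :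
    ∑ s, shellPieceOfDatum₉ F N ϑ D g₀ os p g k ρ t a s ≤ c * ∑ s, cubeWeightOfDatum₉ F N ϑ D g₀ os p g k t a s := by
  rw [← toReal_cubeLawOfDatum₉_fail F N ϑ D g₀ os p g k hU hw0 ρ t a hint, ← toReal_cubeLawOfDatum₉_univ F N ϑ D g₀ os p g k hw0 t a hint,
    ← ENNReal.toReal_ofReal hc, ← ENNReal.toReal_mul]
  exact ENNReal.toReal_mono (ENNReal.mul_ne_top ENNReal.ofReal_ne_top (cubeLawOfDatum₉_univ_lt_top F N ϑ D g₀ os p g k hw0 t a hint).ne) h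

/-- ★★★ **(M1) AS `T4ShellMeasure.SlotAntiConcentration` ON THE RECORD's TRUNCATED LAW ⇒ THE INTEGRAL-FORM (M1).**  For ANY statistic `u` reading cube `a`'s two tests
(`u V < ε_k ↔ χ_a^{ε_k}(V) = 1` and `u V < ε_k(1−ρ) ↔ χ_a^{ε_k(1−ρ)}(V) = 1` — e.g. `u` = the cube sup over `p ⊂ a^∼` of `|U_{k,a}(V)(∂p) − 1| ∕ η_k²`):
`SlotAntiConcentration (cubeLawOfDatum₉ … t a) u ε_k ρ D` (`0 ≤ D`, `0 ≤ ρ`) ⇒ `Σ_s shellPiece … ρ t a s ≤ (D ρ)·Σ_s cubeWeight … t a s` — since the lowered-failure event is the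
shell `{ε_k(1−ρ) ≤ u < ε_k}` plus the null event «`a` fails its own test» (§1). [bookkeeping] -/
theorem cubeAC_of_slotAntiConcentration (hU : LocalBgMeasurable F N ϑ.ν) (hw0 : ∀ k s' U V', 0 ≤ wOfRecord₉ F N ϑ p g k s' U V') {ρ : ℝ} (hρ : 0 ≤ ρ)
    (t : ℝ) (a : ↥(cubeIndices (F.P p.K) (cubeSide (F.P p.K).L ϑ.ν.M₂ (RkOfRecord (F.P p.K).L ϑ.ν.r (g k)) k)))
    (hint : ∀ s : SeqOfRecord F ϑ.ν ϑ.τ9.M g p.K k,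
      Integrable (fun V => chiSeqOfRecord F N ϑ.ν ϑ.τ9.M g p.K k s V * dressedSlotsOfDatum₉ F N ϑ D g₀ os t p g k s V) (fieldMeasure (F.P p.K) k (SU N)))
    (u : GaugeField (F.P p.K) k (SU N) → ℝ)
    (hu : ∀ V, u V < epsOfRecord ϑ.ν g k ↔ cubeChiAt F N ϑ.ν g p.K k (epsOfRecord ϑ.ν g k) a V = 1)
    (hu' : ∀ V, u V < epsOfRecord ϑ.ν g k * (1 - ρ) ↔ cubeChiAt F N ϑ.ν g p.K k (epsOfRecord ϑ.ν g k * (1 - ρ)) a V = 1)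
    {Dc : ℝ} (hD : 0 ≤ Dc) (hAC : SlotAntiConcentration (cubeLawOfDatum₉ F N ϑ D g₀ os p g k t a) u (epsOfRecord ϑ.ν g k) ρ Dc) :
    ∑ s, shellPieceOfDatum₉ F N ϑ D g₀ os p g k ρ t a s ≤ (Dc * ρ) * ∑ s, cubeWeightOfDatum₉ F N ϑ D g₀ os p g k t a s := by
  refine cubeAC_of_lawBound F N ϑ D g₀ os p g k hU hw0 ρ t a hint (mul_nonneg hD hρ) ?_
  -- the lowered-failure event ⊆ shell ∪ own-failure, and own-failure is null
  have hsub : {V | cubeChiAt F N ϑ.ν g p.K k (epsOfRecord ϑ.ν g k * (1 - ρ)) a V = 0} ⊆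
      {V | epsOfRecord ϑ.ν g k * (1 - ρ) ≤ u V ∧ u V < epsOfRecord ϑ.ν g k} ∪
        {V | cubeChiAt F N ϑ.ν g p.K k (epsOfRecord ϑ.ν g k) a V = 0} := by
    intro V hV
    have hfail' : ¬ u V < epsOfRecord ϑ.ν g k * (1 - ρ) := fun hlt => by
      have := (hu' V).1 hlt
      rw [Set.mem_setOf_eq] at hV
      rw [hV] at this
      exact zero_ne_one this
    by_cases hsm : u V < epsOfRecord ϑ.ν g k
    · exact Or.inl ⟨not_lt.1 hfail', hsm⟩
    · right
      rcases cubeChiAt_eq_zero_or_one F N ϑ.ν g p.K k (epsOfRecord ϑ.ν g k) a V with h0 | h1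
      · exact h0
      · exact absurd ((hu V).2 h1) hsm
  calc cubeLawOfDatum₉ F N ϑ D g₀ os p g k t a {V | cubeChiAt F N ϑ.ν g p.K k (epsOfRecord ϑ.ν g k * (1 - ρ)) a V = 0}
      ≤ cubeLawOfDatum₉ F N ϑ D g₀ os p g k t a ({V | epsOfRecord ϑ.ν g k * (1 - ρ) ≤ u V ∧ u V < epsOfRecord ϑ.ν g k} ∪
          {V | cubeChiAt F N ϑ.ν g p.K k (epsOfRecord ϑ.ν g k) a V = 0}) := measure_mono hsub
    _ ≤ cubeLawOfDatum₉ F N ϑ D g₀ os p g k t a {V | epsOfRecord ϑ.ν g k * (1 - ρ) ≤ u V ∧ u V < epsOfRecord ϑ.ν g k} +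
          cubeLawOfDatum₉ F N ϑ D g₀ os p g k t a {V | cubeChiAt F N ϑ.ν g p.K k (epsOfRecord ϑ.ν g k) a V = 0} := measure_union_le _ _
    _ = cubeLawOfDatum₉ F N ϑ D g₀ os p g k t a {V | epsOfRecord ϑ.ν g k * (1 - ρ) ≤ u V ∧ u V < epsOfRecord ϑ.ν g k} := by
          rw [cubeLawOfDatum₉_fail_self_eq_zero F N ϑ D g₀ os p g k hU t a, add_zero]
    _ ≤ ENNReal.ofReal (Dc * ρ) * cubeLawOfDatum₉ F N ϑ D g₀ os p g k t a Set.univ := hAC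

end Law

/-! ## §3 The END's tolerance at the top level: an (M1) constant growing slower than the closeness rate decays is summable -/

/-- **EXPONENTIAL GROWTH BELOW THE RATE IS SUMMABLE**: if the widths decay geometrically, `0 ≤ ρ_K ≤ c₁ ϑ^K`, and the (M1) constants grow at most geometrically,
`0 ≤ D_K ≤ d₀ Γ^K`, with `Γ ϑ < 1` (`0 ≤ ϑ`, `0 ≤ Γ`), then `Σ_K D_K ρ_K < ∞` — the `Summable (D ρ)` hypothesis of `shellWeightBound_classSet₁₃_of_cubeAC`.  (At the top
level the two-run closeness of the cube statistics is a fine-lattice discretisation width, so a per-cube anti-concentration constant may grow like any `Γ^K` with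
`Γ ϑ < 1`; ROW T's `summable_of_pow_mul_geometric` is the polynomial case.) [folklore] -/
theorem summable_of_geomGrowth_mul_geomRate {D ρ : ℕ → ℝ} {d₀ c₁ Γ ϑ : ℝ} (hΓ : 0 ≤ Γ) (hϑ : 0 ≤ ϑ) (hlt : Γ * ϑ < 1)
    (hD0 : ∀ K, 0 ≤ D K) (hD : ∀ K, D K ≤ d₀ * Γ ^ K) (hρ0 : ∀ K, 0 ≤ ρ K) (hρ : ∀ K, ρ K ≤ c₁ * ϑ ^ K) :
    Summable (fun K => D K * ρ K) := by
  have hd₀ : 0 ≤ d₀ := by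
    have := (hD0 0).trans (hD 0); simpa using this
  have hc₁ : 0 ≤ c₁ := by
    have := (hρ0 0).trans (hρ 0); simpa using this
  refine Summable.of_nonneg_of_le (fun K => mul_nonneg (hD0 K) (hρ0 K)) (fun K => ?_)
    ((summable_geometric_of_lt_one (mul_nonneg hΓ hϑ) hlt).mul_left (d₀ * c₁))
  calc D K * ρ K ≤ (d₀ * Γ ^ K) * (c₁ * ϑ ^ K) := mul_le_mul (hD K) (hρ K) (hρ0 K) ((hD0 K).trans (hD K))
    _ = d₀ * c₁ * (Γ * ϑ) ^ K := by rw [mul_pow]; ring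

end Summit.QuantumFields.YangMills.Theorems.N21ShellSplitOfRecord13CoPH

end
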